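import Mathlib.RingTheory.MvPolynomial.Homogeneous
import Mathlib.RingTheory.MvPolynomial.Ideal
import Mathlib.RingTheory.MvPolynomial.Basic
import Mathlib.Algebra.CharP.Two
import Mathlib.Tactic.LinearCombination
import Mathlib.Tactic.Ring
import HarnessLib

/-!
# Crux `Steer` (stmt-ResolutionOfSingularities-16345), chain W4.1: POLYNOMIAL CORES of the «no tangential step» lemma —
# square-plus-form modulo a power of `𝔪` (char 2), restriction of a cone modulo squares, and the multi-vertex lemma
# (res-L0-w41-idea-3 GEN 5; res-L0-w41-tri-3 TRIAGE R-S debts T2 / CLAIM 5 / CLAIM 6 monomial half; res-L0-w41-plan-1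
# RULINGS 114d / 116b; Theses-free research support for res-D-pv-004's `…NoTangentialStep` assembly)

OURS (campaign `res-hironaka`, rung L ★L-G4, slot W4.1; statements about the route's own objects; they replace the
role of no printed item and are NOT statements of the manuscript under review [claim: Hironaka2017, status:
under-review]; AI review is weaker than expert review). Seat res-L0-w41-idea-3 (planner; helper file
`--supports stmt-ResolutionOfSingularities-16345 --as helper`, counted 0). Pure `MvPolynomial` algebra over a field;
no local rings, no valuations, no imports from the campaign tree. Companion of the seat's
`FrobeniusClosingSteerSigmaTopLegalityConeDivisor.lean` ((CD0)–(CD2): the chain-level non-isolatedness bricks).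

## (SQ) Squares and cones

* (SQ1) **`exists_eq_sq_add_isHomogeneous_of_sub_sq_mem_pow`** (`[CharP κ 2]`): `deg C ≤ 2e` and
  `C − h² ∈ (X_i : i)^(2e)` ⇒ `C = q² + C_d`, `C_d` homogeneous of degree `2e`, `q` of degree `< e`
  (Mathlib `MvPolynomial.mem_pow_idealOfVars_iff`, `homogeneousComponent`; the characteristic enters only through
  `(q + r)² = q² + r²`).
* (SQ2) `exists_aeval_eq_add_sq_of_forall_support` (any field, `Fin 4`): `F = A + Q²` with `A` free of `X 1` ⇒
  `F(0, X 1, X 2, X 3) = R + M²` with `R` free of `X 0` and `X 1`.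

## (MV) The multi-vertex lemma (any field, any `p`)

* (MV1) **`exists_add_forall_free_of_forall_exists`**: if for every `w ∈ W` the polynomial `F` splits as `A_w + B_w`
  with `A_w` free of the variable `w` and every monomial of `B_w` a `p`-th power (all exponents divisible by `p`), then
  `F = A + B` with `A` free of EVERY `w ∈ W` and `B` of the same kind, both sub-sums of `F`'s monomials (canonical
  choice: `B` = the `p`-power part of `F`). With `W` = the coordinates adapted to two vertices this is the monomial
  half of «cone over two points ⇒ cone over the line joining them» (CLAIM 6; the `DescentSpace`-level statements are
  res-D-pv-007's `…ConeTwoVertices`).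
* (MV2) `isHomogeneous_of_support_subset`: homogeneity passes to sub-sums.

WHY (informal, not typed here): in the isolated constant-order game G-perf(4, 2e) (`p = 2`, `e ≥ 2`) the restricted
radicand `C` on the newest exceptional divisor has degree `≤ 2e` and is a square modulo `𝔫^(2e)` at the (rational)
centre by the next stage's law, so (SQ1) makes it `q² +` a cone over the centre; if the following centre is
TANGENTIAL (on the strict transform of the divisor), the same cone condition one stage later restricts by (SQ2) to a
BINARY even form modulo squares, which `…SigmaTopLegalityConeDivisor` (CD2)+(CD1″) turns into a non-isolated stage.
The seat's binder-level assembly map is the `Cruxes/Steer` evidence `HNT4-BLUEPRINT.md`. No Theses file is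
imported; nothing here is a route item or a registration. [folklore]
-/

noncomputable section

-- `Summit.<S>.<S>.…` duplicates the summit name by design (single-problem summit).
set_option linter.dupNamespace false

namespace Summit.ResolutionOfSingularities.ResolutionOfSingularities.Theorems.SwitchingDichotomy.ConeSquare

open MvPolynomial

/-! ## (SQ) Squares and cones -/

/-- **(SQ1) «square modulo a high power of `𝔪` ⇒ square plus a form»** (characteristic `2`): if `deg C ≤ 2e` and
`C − h² ∈ 𝔪^(2e)` (`𝔪 = (X_i : i)`), then `C = q² + C_d` with `C_d` homogeneous of degree `2e` and every monomial of
`q` of degree `< e`. Proof: `q :=` the part of `h` of degree `< e`, `r := h − q ∈ 𝔪^e`; in characteristic `2`,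
`h² = q² + r²` and `r² ∈ 𝔪^(2e)`, so `C − q² = (C − h²) + r² ∈ 𝔪^(2e)` has all monomials of degree `≥ 2e`, and
`≤ 2e` by the degree bound. (The polynomial core of «CLAIM 4» of the NoTangential line: the restricted radicand of
cleaned order exactly `2e` at a rational point is a square plus a CONE over the point; res-L0-w41-tri-3 TRIAGE R-S
debt T2; consumed as `hT2` by res-D-pv-004's `…NoTangentialStep` assembly.) OURS. [folklore] -/
theorem exists_eq_sq_add_isHomogeneous_of_sub_sq_mem_pow {κ : Type*} [Field κ] [CharP κ 2] {n : ℕ} (e : ℕ)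
    (C h : MvPolynomial (Fin n) κ) (hdeg : C.totalDegree ≤ 2 * e)
    (hmem : C - h ^ 2 ∈ Ideal.span (Set.range (X : Fin n → MvPolynomial (Fin n) κ)) ^ (2 * e)) :
    ∃ q Cd : MvPolynomial (Fin n) κ,
      C = q ^ 2 + Cd ∧ Cd.IsHomogeneous (2 * e) ∧ ∀ m ∈ q.support, (m.degree : ℕ) < e := by
  classical
  -- `q` = the truncation of `h` below degree `e`
  set q : MvPolynomial (Fin n) κ := ∑ i ∈ Finset.range e, homogeneousComponent i h with hq
  have hcoeff_q : ∀ m : Fin n →₀ ℕ, coeff m q = if (m.degree : ℕ) < e then coeff m h else 0 := by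
    intro m
    rw [hq, MvPolynomial.coeff_sum]
    simp_rw [coeff_homogeneousComponent]
    split_ifs with hm
    · rw [Finset.sum_eq_single_of_mem (m.degree : ℕ) (Finset.mem_range.mpr hm)
        (fun b _ hb => if_neg (Ne.symm hb)), if_pos rfl]
    · refine Finset.sum_eq_zero fun i hi => ?_
      rw [if_neg]
      rintro rfl
      exact hm (Finset.mem_range.mp hi)
  have hq_supp : ∀ m ∈ q.support, (m.degree : ℕ) < e := by
    intro m hm
    rw [MvPolynomial.mem_support_iff, hcoeff_q] at hm
    by_contra hlt
    exact hm (if_neg hlt)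
  have hq_td : q.totalDegree ≤ e := by
    refine totalDegree_finsetSum_le fun i hi => ?_
    exact (homogeneousComponent_isHomogeneous i h).totalDegree_le.trans (Finset.mem_range.mp hi).le
  -- `r := h − q ∈ 𝔪^e`
  have hr : h - q ∈ idealOfVars (Fin n) κ ^ e := by
    rw [mem_pow_idealOfVars_iff']
    intro m hm
    rw [MvPolynomial.coeff_sub, hcoeff_q, if_pos hm, sub_self]
  -- in characteristic 2: `h² = q² + (h − q)²`
  have hsq : h ^ 2 = q ^ 2 + (h - q) ^ 2 := by
    have h2 : (2 : MvPolynomial (Fin n) κ) = 0 := CharTwo.two_eq_zero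
    linear_combination (q * (h - q)) * h2
  have hr2 : (h - q) ^ 2 ∈ idealOfVars (Fin n) κ ^ (2 * e) := by
    rw [two_mul, pow_add, pow_two]
    exact Ideal.mul_mem_mul hr hr
  have hCd : C - q ^ 2 ∈ idealOfVars (Fin n) κ ^ (2 * e) := by
    have hC : C - h ^ 2 ∈ idealOfVars (Fin n) κ ^ (2 * e) := hmem
    have : C - q ^ 2 = (C - h ^ 2) + (h - q) ^ 2 := by rw [hsq]; ring
    rw [this]
    exact add_mem hC hr2
  refine ⟨q, C - q ^ 2, by ring, ?_, hq_supp⟩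
  -- `C − q²` is a `2e`-form: degrees `≤ 2e` (degree bound) and `≥ 2e` (membership in `𝔪^(2e)`)
  have hle : (C - q ^ 2).totalDegree ≤ 2 * e :=
    (totalDegree_sub C (q ^ 2)).trans (max_le hdeg ((totalDegree_pow q 2).trans (by omega)))
  rw [mem_pow_idealOfVars_iff] at hCd
  have hP : C - q ^ 2 = homogeneousComponent (2 * e) (C - q ^ 2) := by
    ext m
    rw [coeff_homogeneousComponent]
    split_ifs with hm
    · rfl
    · by_contra hne
      have hm' : m ∈ (C - q ^ 2).support := MvPolynomial.mem_support_iff.mpr hne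
      have h1 : (∑ a ∈ m.support, m a) ≤ 2 * e := (le_totalDegree hm').trans hle
      have h2 : 2 * e ≤ ∑ a ∈ m.support, m a := (Finsupp.degree_apply m) ▸ hCd m hm'
      exact hm ((Finsupp.degree_apply m).trans (le_antisymm h1 h2))
  rw [hP]
  exact homogeneousComponent_isHomogeneous _ _


/-- **(SQ2) «free of one coordinate modulo squares ⇒ after killing another coordinate, free of both modulo
squares»** (any field; coordinates `Fin 4`, `0 ↦ x̄`, `1 ↦ ȳ′`): if `F = A + Q²` with `A` free of `X 1`, then
`F|_{X 0 = 0} = R + M²` with `R` free of `X 0` and `X 1` — a substitution (`R = A|_{X 0 = 0}`, `M = Q|_{X 0 = 0}`).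
(«CLAIM 5» of the NoTangential line in coordinates ADAPTED to the tangential direction: a cone over the next centre
`[0:1:a:b]` modulo squares restricts on `x̄ = 0` to a BINARY form modulo squares; the content of CLAIM 5 lies in (SQ1),
the vertex bridge and the restriction identity, not here.) OURS. [folklore] -/
theorem exists_aeval_eq_add_sq_of_forall_support {κ : Type*} [Field κ] (F A Q : MvPolynomial (Fin 4) κ)
    (hF : F = A + Q ^ 2) (hA : ∀ m ∈ A.support, m 1 = 0) :
    ∃ R M : MvPolynomial (Fin 4) κ,
      aeval (fun i : Fin 4 => if i = 0 then (0 : MvPolynomial (Fin 4) κ) else X i) F = R + M ^ 2 ∧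
      ∀ m ∈ R.support, m 0 = 0 ∧ m 1 = 0 := by
  classical
  set φ : MvPolynomial (Fin 4) κ →ₐ[κ] MvPolynomial (Fin 4) κ :=
    aeval (fun i : Fin 4 => if i = 0 then (0 : MvPolynomial (Fin 4) κ) else X i) with hφ
  refine ⟨φ A, φ Q, by rw [hF, map_add, map_pow], ?_⟩
  intro m hm
  -- `φ A = Σ_{n ∈ A.support, n 0 = 0} monomial n (coeff n A)`: monomials with `n 0 ≠ 0` die, the others are kept verbatim.
  have key : φ A = ∑ n ∈ A.support with n 0 = 0, monomial n (coeff n A) := by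
    conv_lhs => rw [← support_sum_monomial_coeff A]
    rw [map_sum, ← Finset.sum_filter_add_sum_filter_not A.support (fun n => n 0 = 0)]
    have h1 : ∀ n ∈ A.support.filter (fun n => n 0 = 0), φ (monomial n (coeff n A)) = monomial n (coeff n A) := by
      intro n hn
      rw [Finset.mem_filter] at hn
      rw [hφ, MvPolynomial.aeval_monomial, monomial_eq]
      congr 1
      rw [Finsupp.prod, Finsupp.prod]
      refine Finset.prod_congr rfl fun i hi => ?_
      by_cases hi0 : i = 0
      · subst hi0
        exact absurd hn.2 (Finsupp.mem_support_iff.mp hi)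
      · simp [hi0]
    have h2 : ∀ n ∈ A.support.filter (fun n => ¬ n 0 = 0), φ (monomial n (coeff n A)) = 0 := by
      intro n hn
      rw [Finset.mem_filter] at hn
      rw [hφ, MvPolynomial.aeval_monomial, Finsupp.prod]
      have h0 : (0 : Fin 4) ∈ n.support := Finsupp.mem_support_iff.mpr hn.2
      rw [← Finset.mul_prod_erase _ _ h0]
      simp [hn.2]
    rw [Finset.sum_congr rfl h1, Finset.sum_congr rfl h2, Finset.sum_const_zero, add_zero]
  rw [key] at hm
  obtain ⟨n, hn, hmn⟩ : ∃ n ∈ A.support.filter (fun n => n 0 = 0), m ∈ (monomial n (coeff n A)).support := by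
    by_contra hcon
    have hcon' : ∀ n ∈ A.support.filter (fun n => n 0 = 0), coeff m (monomial n (coeff n A)) = 0 := by
      intro n hn
      by_contra hne
      exact hcon ⟨n, hn, MvPolynomial.mem_support_iff.mpr hne⟩
    have : coeff m (∑ n ∈ A.support with n 0 = 0, monomial n (coeff n A)) = 0 := by
      rw [MvPolynomial.coeff_sum]
      exact Finset.sum_eq_zero hcon'
    exact (MvPolynomial.mem_support_iff.mp hm) this
  rw [Finset.mem_filter] at hn
  have hmn' : m = n := by
    classical
    rw [MvPolynomial.support_monomial] at hmn
    split_ifs at hmn with h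
    · simp at hmn
    · exact Finset.mem_singleton.mp hmn
  subst hmn'
  exact ⟨hn.2, hA m hn.1⟩

/-! ## (MV) The multi-vertex lemma -/

/-- **Multi-vertex lemma.** `F ≡ (free of w) mod κ[X^p]` for each `w ∈ W` ⇒ `F ≡ (free of all w ∈ W) mod κ[X^p]`,
with both parts sub-sums of `F`'s monomials. OURS. [folklore] -/
theorem exists_add_forall_free_of_forall_exists {κ σ : Type*} [Field κ] (p : ℕ) (W : Set σ)
    {F : MvPolynomial σ κ}
    (h : ∀ w ∈ W, ∃ A B : MvPolynomial σ κ,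
      (∀ m ∈ A.support, m w = 0) ∧ (∀ m ∈ B.support, ∀ i, p ∣ m i) ∧ F = A + B) :
    ∃ A B : MvPolynomial σ κ, (∀ m ∈ A.support, ∀ w ∈ W, m w = 0) ∧ (∀ m ∈ B.support, ∀ i, p ∣ m i) ∧
      F = A + B ∧ A.support ⊆ F.support ∧ B.support ⊆ F.support := by
  classical
  set A : MvPolynomial σ κ := ∑ m ∈ F.support with ¬ (∀ i, p ∣ m i), monomial m (coeff m F) with hA
  set B : MvPolynomial σ κ := ∑ m ∈ F.support with (∀ i, p ∣ m i), monomial m (coeff m F) with hB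
  have hAB : F = A + B := by
    conv_lhs => rw [← support_sum_monomial_coeff F]
    rw [hA, hB, add_comm, Finset.sum_filter_add_sum_filter_not]
  have hcoeffA : ∀ n, coeff n A = if (∀ i, p ∣ n i) then 0 else coeff n F := by
    intro n
    rw [hA, MvPolynomial.coeff_sum]
    simp_rw [MvPolynomial.coeff_monomial]
    rw [Finset.sum_ite_eq']
    simp only [Finset.mem_filter, MvPolynomial.mem_support_iff, ne_eq]
    by_cases hn : coeff n F = 0
    · simp [hn]
    · by_cases hnp : ∀ i, p ∣ n i <;> simp [hn, hnp]
  have hcoeffB : ∀ n, coeff n B = if (∀ i, p ∣ n i) then coeff n F else 0 := by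
    intro n
    rw [hB, MvPolynomial.coeff_sum]
    simp_rw [MvPolynomial.coeff_monomial]
    rw [Finset.sum_ite_eq']
    simp only [Finset.mem_filter, MvPolynomial.mem_support_iff, ne_eq]
    by_cases hn : coeff n F = 0
    · simp [hn]
    · by_cases hnp : ∀ i, p ∣ n i <;> simp [hn, hnp]
  have hsuppA : ∀ m ∈ A.support, ¬ (∀ i, p ∣ m i) ∧ coeff m F ≠ 0 := by
    intro m hm
    rw [MvPolynomial.mem_support_iff, hcoeffA] at hm
    by_cases hmp : ∀ i, p ∣ m i
    · rw [if_pos hmp] at hm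
      exact (hm rfl).elim
    · rw [if_neg hmp] at hm
      exact ⟨hmp, hm⟩
  have hsuppB : ∀ m ∈ B.support, (∀ i, p ∣ m i) ∧ coeff m F ≠ 0 := by
    intro m hm
    rw [MvPolynomial.mem_support_iff, hcoeffB] at hm
    by_cases hmp : ∀ i, p ∣ m i
    · rw [if_pos hmp] at hm
      exact ⟨hmp, hm⟩
    · rw [if_neg hmp] at hm
      exact (hm rfl).elim
  refine ⟨A, B, ?_, fun m hm => (hsuppB m hm).1, hAB, ?_, ?_⟩
  · intro m hm w hw
    obtain ⟨hmp, hmF⟩ := hsuppA m hm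
    obtain ⟨Aw, Bw, hAw, hBw, hF⟩ := h w hw
    have hcF : coeff m F = coeff m Aw + coeff m Bw := by rw [hF, MvPolynomial.coeff_add]
    have hcBw : coeff m Bw = 0 := by
      by_contra hne
      exact hmp (hBw m (MvPolynomial.mem_support_iff.mpr hne))
    rw [hcBw, add_zero] at hcF
    have hmAw : m ∈ Aw.support := MvPolynomial.mem_support_iff.mpr (hcF ▸ hmF)
    exact hAw m hmAw
  · intro m hm
    exact MvPolynomial.mem_support_iff.mpr (hsuppA m hm).2
  · intro m hm
    exact MvPolynomial.mem_support_iff.mpr (hsuppB m hm).2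

/-- Homogeneity passes to both parts (they are sub-sums of `F`'s monomials). OURS. [folklore] -/
theorem isHomogeneous_of_support_subset {κ σ : Type*} [Field κ] {F A : MvPolynomial σ κ} {d : ℕ}
    (hF : F.IsHomogeneous d) (hA : A.support ⊆ F.support) : A.IsHomogeneous d := by
  intro m hm
  exact hF (MvPolynomial.mem_support_iff.mp (hA (MvPolynomial.mem_support_iff.mpr hm)))


end Summit.ResolutionOfSingularities.ResolutionOfSingularities.Theorems.SwitchingDichotomy.ConeSquare
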